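import Mathlib.MeasureTheory.Measure.Haar.Unique
import Mathlib.MeasureTheory.Measure.Lebesgue.EqHaar
import HarnessLib

/-!
# Translation-invariant measures on the real line are multiples of Lebesgue measure on windows

Topic `MeasureTheory/Measure`; namespace `Literature.MeasureTheory.Measure`.  THEOREMS ONLY (no definition, no
instance visible to importers, no notation, no named fact, no `sorry`); Mathlib-only imports.  The elementary
consequence of the uniqueness of Haar measure ([Folland1999] Thm 11.9; [Halmos1950] §60 Thm C; Mathlib
`MeasureTheory.Measure.isAddLeftInvariant_eq_smul`) that the T1-qs LAW 2 road of cell `hodgecm-mathlib`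
(crux H413, `TruncatedTracePolynomial`: «`J^T(f)` is a polynomial of degree `≤ 1` in `log T`») consumes in its
step (L2-d) «ray invariance ⇒ linear in `log T`»:

* **`measure_eq_measure_Ioc_smul_volume_of_forall_map_add_eq`** — a Borel measure `μ` on `ℝ` with
  `μ.map (· + s) = μ` for every `s` and `μ (0, 1] < ∞` IS `μ (0, 1] • volume`;
* **`measure_Ioc_eq_mul_of_forall_map_add_eq`** — hence `μ (a, b] = μ (0, 1] · (b − a)` for all `a b`
  (both sides `0` when `b ≤ a`);
* **`exists_map_withDensity_eq_smul_volume`**, **`lintegral_indicator_comp_eq_mul_sub`** — the PUSH-FORWARD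
  framing: on any measure space `(X, μ)` with a measurable «height logarithm» `φ : X → ℝ`, a measurable flow
  `α : ℝ → X → X` preserving `μ` with `φ (α s x) = φ x + s`, and a flow-invariant measurable weight
  `w : X → [0, ∞]` with `∫⁻ 1_{φ ∈ (0,1]} w dμ < ∞`, there is `C < ∞` with
  `∫⁻ 1_{φ ∈ (a,b]} w dμ = C · (b − a)` for all `a b` (the measure `φ_* (w μ)` on `ℝ` is translation
  invariant, finite on the unit cell).

HC_CM is proved only modulo the 7 printed citations until rung 0 closes — nothing here bears on a summit
statement; this is generic measure theory.

## References
* [Folland1999] G. B. Folland, *Real Analysis*, 2nd ed. (1999), Thm 11.9 (uniqueness of Haar measure up to a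
  positive scalar), Thm 2.20 / §1.5 (Lebesgue measure of intervals).
* [Halmos1950] P. R. Halmos, *Measure Theory* (1950), §60 Theorem C (uniqueness of Haar measure).
-/

set_option autoImplicit false

noncomputable section

open MeasureTheory MeasureTheory.Measure Set
open scoped ENNReal NNReal

namespace Literature.MeasureTheory.Measure

/-! ### Translation-invariant measures on `ℝ` -/

section RealLine

variable (μ : Measure ℝ)

/-- Translation invariance in preimage form: `μ ((· + t) ⁻¹' S) = μ S` for measurable `S`.
[cite: Halmos1950, §60 Theorem C] -/
theorem measure_preimage_add_const_of_forall_map_add_eq (hinv : ∀ s : ℝ, μ.map (· + s) = μ) (t : ℝ)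
    {S : Set ℝ} (hS : MeasurableSet S) : μ ((fun x : ℝ => x + t) ⁻¹' S) = μ S := by
  rw [← Measure.map_apply (measurable_add_const t) hS, hinv t]

/-- All unit cells have the same mass: `μ (a, a + 1] = μ (0, 1]`. [cite: Halmos1950, §60 Theorem C] -/
theorem measure_Ioc_add_one_of_forall_map_add_eq (hinv : ∀ s : ℝ, μ.map (· + s) = μ) (a : ℝ) :
    μ (Ioc a (a + 1)) = μ (Ioc 0 1) := by
  have h := measure_preimage_add_const_of_forall_map_add_eq μ hinv (-a) (measurableSet_Ioc (a := 0) (b := 1))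
  rw [preimage_add_const_Ioc] at h
  have e : Ioc (0 - -a) (1 - -a) = Ioc a (a + 1) := by
    congr 1 <;> ring
  rw [e] at h
  exact h

/-- A measure on `ℝ` invariant under all right translations `x ↦ x + s` is left invariant in Mathlib's
sense (`ℝ` is commutative). [cite: Halmos1950, §60 Theorem C] -/
theorem isAddLeftInvariant_of_forall_map_add_eq (hinv : ∀ s : ℝ, μ.map (· + s) = μ) :
    μ.IsAddLeftInvariant := by
  refine ⟨fun g => ?_⟩
  have e : (fun x : ℝ => g + x) = fun x : ℝ => x + g := funext fun x => add_comm g x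
  rw [e]
  exact hinv g

/-- A translation-invariant measure on `ℝ` finite on the unit cell `(0, 1]` is locally finite (every point
has the neighbourhood `(x − 1, x + 1]` of mass `≤ 2 μ (0, 1]`). [cite: Halmos1950, §60 Theorem C] -/
theorem isLocallyFiniteMeasure_of_forall_map_add_eq (hinv : ∀ s : ℝ, μ.map (· + s) = μ)
    (hfin : μ (Ioc 0 1) ≠ ∞) : IsLocallyFiniteMeasure μ := by
  refine ⟨fun x => ⟨Ioc (x - 1) (x + 1), Ioc_mem_nhds (by linarith) (by linarith), ?_⟩⟩
  have hsplit : Ioc (x - 1) (x + 1) = Ioc (x - 1) (x - 1 + 1) ∪ Ioc x (x + 1) := by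
    rw [sub_add_cancel, Ioc_union_Ioc_eq_Ioc (by linarith) (by linarith)]
  calc μ (Ioc (x - 1) (x + 1))
      ≤ μ (Ioc (x - 1) (x - 1 + 1)) + μ (Ioc x (x + 1)) := by
        rw [hsplit]; exact measure_union_le _ _
    _ = μ (Ioc 0 1) + μ (Ioc 0 1) := by
        rw [measure_Ioc_add_one_of_forall_map_add_eq μ hinv, measure_Ioc_add_one_of_forall_map_add_eq μ hinv]
    _ < ∞ := ENNReal.add_lt_top.2 ⟨hfin.lt_top, hfin.lt_top⟩

/-- **A translation-invariant Borel measure on `ℝ` finite on the unit cell is `μ (0,1] • Lebesgue`**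
(uniqueness of Haar measure on the second countable locally compact group `ℝ`; the case `μ = 0` is included).
[cite: Folland1999, Thm 11.9] [cite: Halmos1950, §60 Theorem C] -/
theorem measure_eq_measure_Ioc_smul_volume_of_forall_map_add_eq (hinv : ∀ s : ℝ, μ.map (· + s) = μ)
    (hfin : μ (Ioc 0 1) ≠ ∞) : μ = μ (Ioc 0 1) • (volume : Measure ℝ) := by
  haveI := isAddLeftInvariant_of_forall_map_add_eq μ hinv
  haveI := isLocallyFiniteMeasure_of_forall_map_add_eq μ hinv hfin
  have h : μ = addHaarScalarFactor μ volume • (volume : Measure ℝ) :=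
    Measure.isAddLeftInvariant_eq_smul μ volume
  have hc : μ (Ioc 0 1) = (addHaarScalarFactor μ volume : ℝ≥0∞) := by
    have h1 : μ (Ioc 0 1) = (addHaarScalarFactor μ volume • (volume : Measure ℝ)) (Ioc 0 1) := by
      rw [← h]
    rw [h1, Measure.coe_nnreal_smul_apply, Real.volume_Ioc, sub_zero, ENNReal.ofReal_one, mul_one]
  rw [hc]
  conv_lhs => rw [h]
  rfl

/-- **Windows**: for a translation-invariant Borel measure on `ℝ` finite on the unit cell,
`μ (a, b] = μ (0, 1] · (b − a)` for all real `a, b` (`ENNReal.ofReal (b − a) = 0` when `b ≤ a`, where both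
sides vanish). [cite: Folland1999, Thm 11.9] [cite: Halmos1950, §60 Theorem C] -/
theorem measure_Ioc_eq_mul_of_forall_map_add_eq (hinv : ∀ s : ℝ, μ.map (· + s) = μ)
    (hfin : μ (Ioc 0 1) ≠ ∞) (a b : ℝ) : μ (Ioc a b) = μ (Ioc 0 1) * ENNReal.ofReal (b - a) := by
  have h := congrArg (fun ν : Measure ℝ => ν (Ioc a b))
    (measure_eq_measure_Ioc_smul_volume_of_forall_map_add_eq μ hinv hfin)
  simp only [Measure.smul_apply, smul_eq_mul, Real.volume_Ioc] at h
  exact h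

/-- The same for closed windows `[a, b]` (a point has Lebesgue measure `0`).
[cite: Folland1999, Thm 11.9] [cite: Halmos1950, §60 Theorem C] -/
theorem measure_Icc_eq_mul_of_forall_map_add_eq (hinv : ∀ s : ℝ, μ.map (· + s) = μ)
    (hfin : μ (Ioc 0 1) ≠ ∞) (a b : ℝ) : μ (Icc a b) = μ (Ioc 0 1) * ENNReal.ofReal (b - a) := by
  have h := congrArg (fun ν : Measure ℝ => ν (Icc a b))
    (measure_eq_measure_Ioc_smul_volume_of_forall_map_add_eq μ hinv hfin)
  simp only [Measure.smul_apply, smul_eq_mul, Real.volume_Icc] at h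
  exact h

/-- The same for open windows `(a, b)`. [cite: Folland1999, Thm 11.9] [cite: Halmos1950, §60 Theorem C] -/
theorem measure_Ioo_eq_mul_of_forall_map_add_eq (hinv : ∀ s : ℝ, μ.map (· + s) = μ)
    (hfin : μ (Ioc 0 1) ≠ ∞) (a b : ℝ) : μ (Ioo a b) = μ (Ioc 0 1) * ENNReal.ofReal (b - a) := by
  have h := congrArg (fun ν : Measure ℝ => ν (Ioo a b))
    (measure_eq_measure_Ioc_smul_volume_of_forall_map_add_eq μ hinv hfin)
  simp only [Measure.smul_apply, smul_eq_mul, Real.volume_Ioo] at h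
  exact h

end RealLine

/-! ### The push-forward framing: a flow translating a height logarithm -/

section PushForward

variable {X : Type*} [MeasurableSpace X] (μ : Measure X) (φ : X → ℝ) (w : X → ℝ≥0∞)

/-- The push-forward `φ_* (w · μ)` evaluated on a measurable `S ⊆ ℝ` is `∫⁻ 1_{φ ∈ S} w dμ`.
[cite: Halmos1950, §39 Theorem C] -/
theorem map_withDensity_apply_eq_lintegral_indicator (hφ : Measurable φ) {S : Set ℝ}
    (hS : MeasurableSet S) :
    ((μ.withDensity w).map φ) S = ∫⁻ x, (φ ⁻¹' S).indicator w x ∂μ := by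
  rw [Measure.map_apply hφ hS, withDensity_apply _ (hφ hS), lintegral_indicator (hφ hS)]

/-- **The push-forward of a flow-invariant weight by a translated height is translation invariant.**  If a
measurable self-map `α s` of `X` preserves `μ`, translates `φ` by `s` (`φ (α s x) = φ x + s`) and fixes the
measurable weight `w`, then `(φ_* (w μ)).map (· + s) = φ_* (w μ)`. [cite: Halmos1950, §39 Theorem C] -/
theorem map_add_const_map_withDensity_eq (hφ : Measurable φ) (hw : Measurable w) (s : ℝ) (αs : X → X)
    (hmeas : Measurable αs) (hμ : μ.map αs = μ) (hφα : ∀ x, φ (αs x) = φ x + s)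
    (hwα : ∀ x, w (αs x) = w x) :
    ((μ.withDensity w).map φ).map (· + s) = (μ.withDensity w).map φ := by
  ext S hS
  rw [Measure.map_apply (measurable_add_const s) hS,
    map_withDensity_apply_eq_lintegral_indicator μ φ w hφ (measurable_add_const s hS),
    map_withDensity_apply_eq_lintegral_indicator μ φ w hφ hS]
  have hset : φ ⁻¹' ((fun x : ℝ => x + s) ⁻¹' S) = αs ⁻¹' (φ ⁻¹' S) := by
    ext x
    simp only [mem_preimage, hφα]
  rw [hset]
  calc ∫⁻ x, (αs ⁻¹' (φ ⁻¹' S)).indicator w x ∂μ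
      = ∫⁻ x, ((φ ⁻¹' S).indicator w) (αs x) ∂μ := by
        refine lintegral_congr fun x => ?_
        have hwc : w = w ∘ αs := funext fun y => (hwα y).symm
        calc (αs ⁻¹' (φ ⁻¹' S)).indicator w x
            = (αs ⁻¹' (φ ⁻¹' S)).indicator (w ∘ αs) x := by rw [← hwc]
          _ = (φ ⁻¹' S).indicator w (αs x) := Set.indicator_comp_right αs
    _ = ∫⁻ y, (φ ⁻¹' S).indicator w y ∂(μ.map αs) :=
        (lintegral_map (hw.indicator (hφ hS)) hmeas).symm
    _ = ∫⁻ y, (φ ⁻¹' S).indicator w y ∂μ := by rw [hμ]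

/-- **Push-forward form, measure level.**  Under a `μ`-preserving measurable flow `α : ℝ → X → X` translating
the measurable height logarithm `φ` (`φ (α s x) = φ x + s`) and fixing the measurable weight `w`, with
`∫⁻ 1_{φ ∈ (0,1]} w dμ < ∞`, the measure `φ_* (w μ)` on `ℝ` is `C • volume` with
`C = ∫⁻ 1_{φ ∈ (0,1]} w dμ < ∞`. [cite: Folland1999, Thm 11.9] [cite: Halmos1950, §60 Theorem C] -/
theorem map_withDensity_eq_lintegral_indicator_smul_volume (hφ : Measurable φ) (hw : Measurable w)
    (α : ℝ → X → X) (hmeas : ∀ s, Measurable (α s)) (hμα : ∀ s, μ.map (α s) = μ)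
    (hφα : ∀ s x, φ (α s x) = φ x + s) (hwα : ∀ s x, w (α s x) = w x)
    (hfin : ∫⁻ x, {x | φ x ∈ Ioc (0 : ℝ) 1}.indicator w x ∂μ ≠ ∞) :
    (μ.withDensity w).map φ = (∫⁻ x, {x | φ x ∈ Ioc (0 : ℝ) 1}.indicator w x ∂μ) • (volume : Measure ℝ) := by
  have hinv : ∀ s : ℝ, ((μ.withDensity w).map φ).map (· + s) = (μ.withDensity w).map φ := fun s =>
    map_add_const_map_withDensity_eq μ φ w hφ hw s (α s) (hmeas s) (hμα s) (hφα s) (hwα s)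
  have h01 : ((μ.withDensity w).map φ) (Ioc 0 1) = ∫⁻ x, {x | φ x ∈ Ioc (0 : ℝ) 1}.indicator w x ∂μ :=
    map_withDensity_apply_eq_lintegral_indicator μ φ w hφ measurableSet_Ioc
  have h := measure_eq_measure_Ioc_smul_volume_of_forall_map_add_eq _ hinv (by rwa [h01])
  rwa [h01] at h

/-- **Push-forward form, windows** (the letter the torus half of the LAW 2 road consumes): under a
`μ`-preserving measurable flow translating the measurable height logarithm `φ` and fixing the measurable weight
`w`, with `∫⁻ 1_{φ ∈ (0,1]} w dμ < ∞`, there is `C < ∞` such that `∫⁻ 1_{φ ∈ (a,b]} w dμ = C · (b − a)` for all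
real `a, b` (both sides `0` when `b ≤ a`); in fact `C = ∫⁻ 1_{φ ∈ (0,1]} w dμ`.
[cite: Folland1999, Thm 11.9] [cite: Halmos1950, §60 Theorem C] -/
theorem lintegral_indicator_comp_eq_mul_sub (hφ : Measurable φ) (α : ℝ → X → X)
    (hmeas : ∀ s, Measurable (α s)) (hμα : ∀ s, μ.map (α s) = μ) (hφα : ∀ s x, φ (α s x) = φ x + s)
    (hw : Measurable w) (hwα : ∀ s x, w (α s x) = w x)
    (hfin : ∫⁻ x, {x | φ x ∈ Ioc (0 : ℝ) 1}.indicator w x ∂μ ≠ ∞) :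
    ∃ C : ℝ≥0∞, C ≠ ∞ ∧ ∀ a b : ℝ,
      ∫⁻ x, {x | φ x ∈ Ioc a b}.indicator w x ∂μ = C * ENNReal.ofReal (b - a) := by
  refine ⟨∫⁻ x, {x | φ x ∈ Ioc (0 : ℝ) 1}.indicator w x ∂μ, hfin, fun a b => ?_⟩
  have h := congrArg (fun ν : Measure ℝ => ν (Ioc a b))
    (map_withDensity_eq_lintegral_indicator_smul_volume μ φ w hφ hw α hmeas hμα hφα hwα hfin)
  simp only [Measure.smul_apply, smul_eq_mul, Real.volume_Ioc] at h
  rwa [map_withDensity_apply_eq_lintegral_indicator μ φ w hφ measurableSet_Ioc] at h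

end PushForward

end Literature.MeasureTheory.Measure
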